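import Literature.NumberTheory.EllipticCurves.TorsionThreeNormalForm
import Literature.NumberTheory.EllipticCurves.DivisionValuesOmegaIdentityProofs
import HarnessLib

/-!
# The Kummer tripling identity on `y² + a₁xy + a₃y = x³`: `ω₃ = G³`, so `y(3Q) = (G(Q)/ψ₃(Q))³`

Summit `BirchSwinnertonDyer`, route `ManinLocalTwoThree` (cell bsd-f2-manin), crux C3 `ManinPrimeToThreeAtNine`
(stmt-BirchSwinnertonDyer-22968), reducible residual of the line `kato_shift_three`; first brick of the proof of
E-an-55 `…ManinAdditive.CuspidalKummerThree.ManinThreeKummerCube` (MEMO-an §56.7: `3 ∣ c` cubes the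
tangent-line Kummer class), the one input of the `p = 3` certificate E-an-58 left open by
`ManinLocalTwoThreeManinPrimeToThreeOfEtaExponentOfCube`.

KUMMER THEORY OF `[3]` MADE POLYNOMIAL.  On the normal form `E₃(a₁, a₃) : y² + a₁xy + a₃y = x³` of a curve
with the point `T = (0,0)` of order `3` (`WeierstrassCurve.kubertThree`; the tangent line at `T` is `y = 0`,
`div y = 3(T) − 3(O)`), the function `y ∘ [3]` has divisor `3·[3]^*((T) − (O))`, so it is a constant times a
cube; clearing the poles with `ψ₃` this says that the third division value `ω₃` (the numerator of
`y([3]Q) = ω₃(Q)/ψ₃(Q)³`, Silverman *AEC* Exercise 3.7(d); the tree's `UnivEC.ω`) is a PERFECT CUBE in the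
coordinate ring:

  `ω₃ = G³`,  `G = x³y − 4a₃x³ − a₁a₃xy − a₁²a₃x² − 2a₃²y − 2a₁a₃²x − a₃³ = y·(x³ − a₁a₃x − 2a₃²) − a₃·Ψ₂Sq(x)`.

* `kubert_two_mul_cube_eq` — the ring identity `2G³ = u(preΨ₄u⁴ − Ψ₃³ − preΨ₄²) − a₁(xΨ₃² − preΨ₄u²)Ψ₃ −
  a₃Ψ₃³` (`u = 2y + a₁x + a₃`) modulo the equation, by one `linear_combination`;
* `kubert_ωEval_three` — for a point `(x, y)` of `E₃(a₁, a₃)` over a field with `2 ≠ 0`, `ψ₂(Q) ≠ 0`,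
  `ψ₃(Q) ≠ 0`: `ω₃(Q) = G(Q)³` (from the tree's `2ω₃ψ₃ = ψ₆ − a₁φ₃ψ₃² − a₃ψ₃⁴`,
  `DivisionValuesOmegaIdentityProofs`, and Mathlib's recursion `ψ₆ψ₂ = ψ₂²ψ₃ψ₅ − ψ₁ψ₃ψ₄²`,
  `ψ₅ = ψ₄ψ₂³ − ψ₁ψ₃³`);
* `kubert_y_three_smul` — **if `3 • Q = (x₃, y₃)` then `y₃ · ψ₃(Q)³ = G(Q)³`** (the tree's multiplication
  formula `[n]Q = (φₙ/ψₙ², ωₙ/ψₙ³)`, `DivisionPolynomialMultiplication`).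

No definitions; nothing about BSD, Manin's conjecture or any Manin constant is asserted here.
-/

set_option autoImplicit false
set_option linter.dupNamespace false

noncomputable section

open scoped Classical
open Polynomial WeierstrassCurve Literature.NumberTheory.EllipticCurves

namespace Summit.BirchSwinnertonDyer.BirchSwinnertonDyer.Theorems.ManinLocalTwoThree

/-! ### §1 The cube identity in the coordinate ring -/

section Ring

variable {R : Type*} [CommRing R] (a₁ a₃ : R)

/-- `Ψ₃` of `E₃(a₁, a₃)` explicitly: `3x⁴ + a₁²x³ + 3a₁a₃x² + 3a₃²x` (`b₂ = a₁²`, `b₄ = a₁a₃`, `b₆ = a₃²`,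
`b₈ = 0`). [cite: SilvermanAEC2009, Exercise 3.7] -/
theorem kubert_Ψ₃_eval (x : R) : (kubertThree a₁ a₃).Ψ₃.eval x =
    3 * x ^ 4 + a₁ ^ 2 * x ^ 3 + 3 * (a₁ * a₃) * x ^ 2 + 3 * a₃ ^ 2 * x := by
  simp only [WeierstrassCurve.Ψ₃, kubertThree, WeierstrassCurve.b₂, WeierstrassCurve.b₄, WeierstrassCurve.b₆,
    WeierstrassCurve.b₈, eval_add, eval_mul, eval_pow, eval_C, eval_X, eval_ofNat]
  ring

/-- `preΨ₄` of `E₃(a₁, a₃)` explicitly: `2x⁶ + a₁²x⁵ + 5a₁a₃x⁴ + 10a₃²x³ − a₁a₃³x − a₃⁴`.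
[cite: SilvermanAEC2009, Exercise 3.7] -/
theorem kubert_preΨ₄_eval (x : R) : (kubertThree a₁ a₃).preΨ₄.eval x =
    2 * x ^ 6 + a₁ ^ 2 * x ^ 5 + 5 * (a₁ * a₃) * x ^ 4 + 10 * a₃ ^ 2 * x ^ 3 - a₁ * a₃ ^ 3 * x - a₃ ^ 4 := by
  simp only [WeierstrassCurve.preΨ₄, kubertThree, WeierstrassCurve.b₂, WeierstrassCurve.b₄, WeierstrassCurve.b₆,
    WeierstrassCurve.b₈, eval_add, eval_mul, eval_pow, eval_C, eval_X, eval_ofNat]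
  ring

/-- **The Kummer tripling identity in the coordinate ring of `E₃(a₁, a₃)`.** With `u = 2y + a₁x + a₃`,
`Ψ₃ = Ψ₃(x)`, `Π = preΨ₄(x)` and `G = x³y − 4a₃x³ − a₁a₃xy − a₁²a₃x² − 2a₃²y − 2a₁a₃²x − a₃³`, on the curve
`y² + a₁xy + a₃y = x³`:  `2G³ = u(Πu⁴ − Ψ₃³ − Π²) − a₁(xΨ₃² − Πu²)Ψ₃ − a₃Ψ₃³` (the right side is `2ω₃`,
see `kubert_ωEval_three`). [cite: SilvermanAEC2009, Exercise 3.7(d) (shape: the division values; the cube identity is this file's)] -/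
theorem kubert_two_mul_cube_eq {x y : R} (heq : y ^ 2 + a₁ * x * y + a₃ * y = x ^ 3) :
    2 * (x ^ 3 * y - 4 * a₃ * x ^ 3 - a₁ * a₃ * x * y - a₁ ^ 2 * a₃ * x ^ 2 - 2 * a₃ ^ 2 * y
        - 2 * a₁ * a₃ ^ 2 * x - a₃ ^ 3) ^ 3 =
      (2 * y + a₁ * x + a₃) *
          ((kubertThree a₁ a₃).preΨ₄.eval x * (2 * y + a₁ * x + a₃) ^ 4 - ((kubertThree a₁ a₃).Ψ₃.eval x) ^ 3
            - ((kubertThree a₁ a₃).preΨ₄.eval x) ^ 2)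
        - a₁ * (x * ((kubertThree a₁ a₃).Ψ₃.eval x) ^ 2
            - (kubertThree a₁ a₃).preΨ₄.eval x * (2 * y + a₁ * x + a₃) ^ 2) * (kubertThree a₁ a₃).Ψ₃.eval x
        - a₃ * ((kubertThree a₁ a₃).Ψ₃.eval x) ^ 3 := by
  rw [kubert_Ψ₃_eval, kubert_preΨ₄_eval]
  linear_combination ((-64) * x ^ 6 * y ^ 3 + (-62) * x ^ 9 * y + (-96) * a₁ * x ^ 7 * y ^ 2 + (-58) * a₁ * x ^ 10
    + (-32) * a₁ ^ 2 * x ^ 5 * y ^ 3 + (-96) * a₁ ^ 2 * x ^ 8 * y + (-96) * a₃ * x ^ 6 * y ^ 2 + (-58) * a₃ * x ^ 9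
    + (-48) * a₁ ^ 3 * x ^ 6 * y ^ 2 + (-52) * a₁ ^ 3 * x ^ 9 + (-160) * a₁ * a₃ * x ^ 4 * y ^ 3
    + (-294) * a₁ * a₃ * x ^ 7 * y + (-32) * a₁ ^ 4 * x ^ 7 * y + (-288) * a₁ ^ 2 * a₃ * x ^ 5 * y ^ 2
    + (-228) * a₁ ^ 2 * a₃ * x ^ 8 + (-12) * a₁ ^ 5 * x ^ 8 + (-320) * a₃ ^ 2 * x ^ 3 * y ^ 3
    + (-396) * a₃ ^ 2 * x ^ 6 * y + (-224) * a₁ ^ 3 * a₃ * x ^ 6 * y + (-720) * a₁ * a₃ ^ 2 * x ^ 4 * y ^ 2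
    + (-378) * a₁ * a₃ ^ 2 * x ^ 7 + (-96) * a₁ ^ 4 * a₃ * x ^ 7 + (-666) * a₁ ^ 2 * a₃ ^ 2 * x ^ 5 * y
    + (-480) * a₃ ^ 3 * x ^ 3 * y ^ 2 + (-74) * a₃ ^ 3 * x ^ 6 + (-330) * a₁ ^ 3 * a₃ ^ 2 * x ^ 6
    + 32 * a₁ * a₃ ^ 3 * x * y ^ 3 + (-744) * a₁ * a₃ ^ 3 * x ^ 4 * y + 48 * a₁ ^ 2 * a₃ ^ 3 * x ^ 2 * y ^ 2
    + (-526) * a₁ ^ 2 * a₃ ^ 3 * x ^ 5 + 32 * a₃ ^ 4 * y ^ 3 + (-264) * a₃ ^ 4 * x ^ 3 * y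
    + 30 * a₁ ^ 3 * a₃ ^ 3 * x ^ 3 * y + 96 * a₁ * a₃ ^ 4 * x * y ^ 2 + (-440) * a₁ * a₃ ^ 4 * x ^ 4
    + 8 * a₁ ^ 4 * a₃ ^ 3 * x ^ 4 + 84 * a₁ ^ 2 * a₃ ^ 4 * x ^ 2 * y + 48 * a₃ ^ 5 * y ^ 2 + (-160) * a₃ ^ 5 * x ^ 3
    + 26 * a₁ ^ 3 * a₃ ^ 4 * x ^ 3 + 72 * a₁ * a₃ ^ 5 * x * y + 30 * a₁ ^ 2 * a₃ ^ 5 * x ^ 2 + 16 * a₃ ^ 6 * y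
    + 12 * a₁ * a₃ ^ 6 * x) * heq

end Ring

/-! ### §2 `ω₃(Q) = G(Q)³` at a point, and the `y`-coordinate of `3 • Q` -/

section Field

variable {F : Type*} [Field F] {a₁ a₃ x y : F}

/-- On `E₃(a₁, a₃)`: `ψ₂(Q) = 2y + a₁x + a₃`, `ψ₃(Q) = Ψ₃(x)`, `ψ₄(Q) = preΨ₄(x)ψ₂(Q)` (evaluation of
Mathlib's bivariate division polynomials). [cite: SilvermanAEC2009, Exercise 3.7] -/
theorem kubert_evalEval_ψ_two_three_four (x y : F) :
    ((kubertThree a₁ a₃).ψ 2).evalEval x y = 2 * y + a₁ * x + a₃ ∧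
      ((kubertThree a₁ a₃).ψ 3).evalEval x y = (kubertThree a₁ a₃).Ψ₃.eval x ∧
      ((kubertThree a₁ a₃).ψ 4).evalEval x y = (kubertThree a₁ a₃).preΨ₄.eval x * (2 * y + a₁ * x + a₃) := by
  refine ⟨?_, ?_, ?_⟩
  · rw [WeierstrassCurve.ψ_two, WeierstrassCurve.ψ₂, Affine.evalEval_polynomialY]; rfl
  · rw [WeierstrassCurve.ψ_three, evalEval_C]
  · rw [WeierstrassCurve.ψ_four, evalEval_mul, evalEval_C, WeierstrassCurve.ψ₂, Affine.evalEval_polynomialY]; rfl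

/-- **`ω₃(Q) = G(Q)³` on `E₃(a₁, a₃)`** over a field with `2 ≠ 0`, at a point `Q = (x, y)` of the curve with
`ψ₂(Q) ≠ 0` and `ψ₃(Q) ≠ 0` (`ωEval` = the tree's specialised universal `ω₃`): the third division value is a
perfect cube.  From `2ω₃ψ₃ = ψ₆ − a₁φ₃ψ₃² − a₃ψ₃⁴` (`two_mul_ev_ω_mul_evalEval_ψ`), the recursion
`ψ₆ψ₂ = ψ₂²ψ₃ψ₅ − ψ₁ψ₃ψ₄²`, `ψ₅ = ψ₄ψ₂³ − ψ₁ψ₃³`, `φ₃ = xψ₃² − ψ₄ψ₂`, and `kubert_two_mul_cube_eq`.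
[cite: SilvermanAEC2009, Exercise 3.7(d) (shape: the division values; the cube identity is this file's)] -/
theorem kubert_ωEval_three (h : (kubertThree a₁ a₃).toAffine.Equation x y) (h2 : (2 : F) ≠ 0)
    (hu : 2 * y + a₁ * x + a₃ ≠ 0) (hψ₃ : (kubertThree a₁ a₃).Ψ₃.eval x ≠ 0) :
    Affine.Point.ωEval (kubertThree a₁ a₃) x y 3 =
      (x ^ 3 * y - 4 * a₃ * x ^ 3 - a₁ * a₃ * x * y - a₁ ^ 2 * a₃ * x ^ 2 - 2 * a₃ ^ 2 * y
        - 2 * a₁ * a₃ ^ 2 * x - a₃ ^ 3) ^ 3 := by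
  set W := kubertThree a₁ a₃ with hW
  obtain ⟨e2, e3, e4⟩ := kubert_evalEval_ψ_two_three_four (a₁ := a₁) (a₃ := a₃) x y
  have key := WeierstrassCurve.two_mul_ev_ω_mul_evalEval_ψ W h 3
  -- `ψ₅(Q)` and `ψ₆(Q)`
  have e5 : (W.ψ 5).evalEval x y = W.preΨ₄.eval x * (2 * y + a₁ * x + a₃) ^ 4 - (W.Ψ₃.eval x) ^ 3 := by
    have h5 := W.ψ_odd 2
    rw [show (2 * 2 + 1 : ℤ) = 5 by norm_num, show (2 + 2 : ℤ) = 4 by norm_num, show (2 - 1 : ℤ) = 1 by norm_num,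
      show (2 + 1 : ℤ) = 3 by norm_num, WeierstrassCurve.ψ_one, one_mul] at h5
    have h5' := congrArg (Polynomial.evalEval x y) h5
    rw [evalEval_sub, evalEval_mul, evalEval_pow, evalEval_pow, e2, e3, e4] at h5'
    rw [h5']; ring
  have e6 : (W.ψ (2 * 3)).evalEval x y =
      (2 * y + a₁ * x + a₃) * W.Ψ₃.eval x *
        (W.preΨ₄.eval x * (2 * y + a₁ * x + a₃) ^ 4 - (W.Ψ₃.eval x) ^ 3 - (W.preΨ₄.eval x) ^ 2) := by
    have h6 := W.ψ_even 3
    rw [show (3 - 1 : ℤ) = 2 by norm_num, show (3 + 2 : ℤ) = 5 by norm_num, show (3 - 2 : ℤ) = 1 by norm_num,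
      show (3 + 1 : ℤ) = 4 by norm_num, WeierstrassCurve.ψ_one, one_mul] at h6
    have h6' := congrArg (Polynomial.evalEval x y) h6
    rw [evalEval_mul, evalEval_sub, evalEval_mul, evalEval_mul, evalEval_mul, evalEval_pow, evalEval_pow,
      WeierstrassCurve.ψ₂, Affine.evalEval_polynomialY, e2, e3, e4, e5] at h6'
    have hu' : (2 : F) * y + W.a₁ * x + W.a₃ = 2 * y + a₁ * x + a₃ := rfl
    rw [hu'] at h6'
    have : ((W.ψ (2 * 3)).evalEval x y - (2 * y + a₁ * x + a₃) * W.Ψ₃.eval x *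
        (W.preΨ₄.eval x * (2 * y + a₁ * x + a₃) ^ 4 - (W.Ψ₃.eval x) ^ 3 - (W.preΨ₄.eval x) ^ 2)) *
          (2 * y + a₁ * x + a₃) = 0 := by
      linear_combination h6'
    rcases mul_eq_zero.mp this with h0 | h0
    · exact sub_eq_zero.mp h0
    · exact absurd h0 hu
  -- `φ₃(Q)`
  have eφ : (W.φ 3).evalEval x y = x * (W.Ψ₃.eval x) ^ 2 - W.preΨ₄.eval x * (2 * y + a₁ * x + a₃) ^ 2 := by
    rw [WeierstrassCurve.φ_three, evalEval_sub, evalEval_mul, evalEval_mul, evalEval_C, evalEval_C, evalEval_pow,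
      evalEval_pow, evalEval_C, eval_X, WeierstrassCurve.ψ₂, Affine.evalEval_polynomialY]
    rfl
  rw [e3, e6, eφ] at key
  have ha₁ : W.a₁ = a₁ := rfl
  have ha₃ : W.a₃ = a₃ := rfl
  rw [ha₁, ha₃] at key
  have heq : y ^ 2 + a₁ * x * y + a₃ * y = x ^ 3 := by
    have := (Affine.equation_iff' x y).mp h
    simp only [hW, kubertThree] at this
    linear_combination this
  have hcube := kubert_two_mul_cube_eq a₁ a₃ heq
  -- cancel `2 Ψ₃(x)`
  have : (Affine.Point.ωEval W x y 3 -
      (x ^ 3 * y - 4 * a₃ * x ^ 3 - a₁ * a₃ * x * y - a₁ ^ 2 * a₃ * x ^ 2 - 2 * a₃ ^ 2 * y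
        - 2 * a₁ * a₃ ^ 2 * x - a₃ ^ 3) ^ 3) * (2 * W.Ψ₃.eval x) = 0 := by
    rw [Affine.Point.ωEval]
    linear_combination key - W.Ψ₃.eval x * hcube
  rcases mul_eq_zero.mp this with h0 | h0
  · exact sub_eq_zero.mp h0
  · exact absurd h0 (mul_ne_zero h2 hψ₃)

/-- **The `y`-coordinate of `3 • Q` on `E₃(a₁, a₃)` is a cube**: if `Q = (x, y)` is a nonsingular point with
`ψ₂(Q) ≠ 0` (over a field with `2 ≠ 0`) and `3 • Q = (x₃, y₃)` is affine, then `y₃ · Ψ₃(x)³ = G(Q)³` — i.e.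
`y(3Q) = (G(Q)/ψ₃(Q))³`, the polynomial form of `div(y ∘ [3]) = 3·[3]^*((T) − (O))` for the flex `T = (0,0)`.
[cite: SilvermanAEC2009, Exercise 3.7(d)] -/
theorem kubert_y_three_smul (hns : (kubertThree a₁ a₃).toAffine.Nonsingular x y) (h2 : (2 : F) ≠ 0)
    (hu : 2 * y + a₁ * x + a₃ ≠ 0) {x₃ y₃ : F} {h₃ : (kubertThree a₁ a₃).toAffine.Nonsingular x₃ y₃}
    (hP : 3 • Affine.Point.some x y hns = Affine.Point.some x₃ y₃ h₃) :
    y₃ * ((kubertThree a₁ a₃).Ψ₃.eval x) ^ 3 =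
      (x ^ 3 * y - 4 * a₃ * x ^ 3 - a₁ * a₃ * x * y - a₁ ^ 2 * a₃ * x ^ 2 - 2 * a₃ ^ 2 * y
        - 2 * a₁ * a₃ ^ 2 * x - a₃ ^ 3) ^ 3 ∧
      x₃ * ((kubertThree a₁ a₃).Ψ₃.eval x) ^ 2 = ((kubertThree a₁ a₃).φ 3).evalEval x y := by
  have e3 : ((kubertThree a₁ a₃).ψ 3).evalEval x y = (kubertThree a₁ a₃).Ψ₃.eval x :=
    (kubert_evalEval_ψ_two_three_four (a₁ := a₁) (a₃ := a₃) x y).2.1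
  have h33 : (3 : ℤ) • Affine.Point.some x y hns = 3 • Affine.Point.some x y hns := natCast_zsmul _ 3
  -- `ψ₃(Q) ≠ 0` since `3 • Q ≠ O`
  have hψ3 : ((kubertThree a₁ a₃).ψ 3).evalEval x y ≠ 0 := by
    intro h0
    have h30 : (3 : ℤ) • Affine.Point.some x y hns = 0 :=
      (Affine.Point.zsmul_some_eq_zero_iff hns 3).mpr h0
    rw [h33, hP] at h30
    exact Affine.Point.some_ne_zero _ h30
  have hψ₃ : (kubertThree a₁ a₃).Ψ₃.eval x ≠ 0 := e3 ▸ hψ3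
  obtain ⟨hns', h3⟩ := Affine.Point.zsmul_some_eq_of_evalEval_ψ_ne_zero hns (n := 3) hψ3
  rw [h33, hP] at h3
  obtain ⟨hx, hy⟩ := (Affine.Point.some.injEq _ _ _ _ _ _).mp h3
  rw [e3] at hx hy
  refine ⟨?_, ?_⟩
  · rw [hy, kubert_ωEval_three hns.1 h2 hu hψ₃]
    field_simp
  · rw [hx]
    field_simp

end Field

end Summit.BirchSwinnertonDyer.BirchSwinnertonDyer.Theorems.ManinLocalTwoThree

end
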